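import Summits.ResolutionOfSingularities.ResolutionOfSingularities.Theorems.RadicialJungCleanModelsReadOffOffCritical
import HarnessLib

/-!
# [OURS · L W8.1 · T2 brick B7, PART (3), landing 1] The (c-1)/(c-2) READER of Giraud's normal form at a critical point:
# a triangular-derivations criterion for differential freeness, and `f = gᵖ + u·x^A·y^B` with ONE unit generator of `I_g` ⇒
# `Giraud15NormalFormAt p f`

Programme `PROGRAMME-clean-dim2` / T2 (res-L0-w81-pv-2 g5), spec `HOME/L/res-L0-w81-pv-2/g5/B7-SPEC.md` §(3) «KEY ALGEBRA (F-96-free)»;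
crux `stmt-ResolutionOfSingularities-0549`, stub `stub_cleanModels` (= stmt-…-15917); `--supports … --as helper` by res-L1-s13-pv-1 g7 (custody
DEAL #63 (1)).  OURS; nothing here is a statement of H. Hironaka's manuscript; AI-written, weaker than expert review.

Giraud 1983, Prop. 1.5 (ii) at a point `ξ` of `E(f)` where (*) holds and `c = 0`: in the regular local ring `O = 𝒪_{X,ξ}` of dimension `2`
with regular system of parameters `(x, y)` cutting out `E(f)` (`r = 2`: crossing, `E(f) = V(xy)`; `r = 1`: `E(f) = V(x)`), once some `g`
realises `f − gᵖ = u·x^A·y^B` (`A, B ≥ 2`; resp. `u·x^A`) with ONE of the generators of the spec's ideal `I_g` a UNIT — `A·u + x∂ₓu` or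
`B·u + y∂_y u` (then `p ∤ A` resp. `p ∤ B` and `u` is a unit: case (c-1)), or `D u` for a derivation `D` killing the boundary letters modulo
`𝔪` (then `(x, y, u)` resp. `(x, u)` is DIFFERENTIALLY FREE: case (c-2)) —, `f` is in Giraud's normal form `Giraud15NormalFormAt p f`.  The
(c-2) half rests on a general criterion: a family `y₀, …, y_{n−1}` admitting derivations `E₀, …, E_{n−1}` with `Eᵢ(yᵢ) ∉ 𝔪` and
`Eᵢ(yⱼ) ∈ 𝔪` for `j < i` is differentially free (the functionals `κ ⊗ Ω → κ`, `1 ⊗ dh ↦ \overline{Eᵢ h}` — pv-2's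
`one_tmul_D_ne_zero_of_derivation_apply_not_mem`, p562256, made `κ`-linear — give a unitriangular system).  Landing 2 (the COMPUTATION
`J(O, f; log x, y) = x^A y^B · I_g` and «`J = (x^a y^b)` ⇒ (`I_g = O ⟺ A = a ∧ B = b`)») follows separately.

* § 1 `exists_residueFunctional` — for `D ∈ Der_ℤ(O)` a `κ`-linear `Ψ : κ ⊗_O Ω_{O/ℤ} → κ` with `Ψ(1 ⊗ dh) = \overline{D h}`;
  **`isDifferentiallyFree_of_triangular`** — the unitriangular criterion.
* § 2 (c-1): `giraud15NormalFormAt_crossing_of_isUnit`, `giraud15NormalFormAt_noncrossing_of_isUnit`; the unit-generator forms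
  `…_of_isUnit_generator` (`A·u + x·v` a unit ⇒ `p ∤ A` and `u` a unit).
* § 3 (c-2): `giraud15NormalFormAt_crossing_of_derivations`, `giraud15NormalFormAt_noncrossing_of_derivations`.
-/

set_option linter.dupNamespace false -- mandated namespace `Summit.<Summit>.<Problem>` of this single-conjunct summit

noncomputable section

open IsLocalRing KaehlerDifferential
open Literature.AlgebraicGeometry.Resolution
open scoped TensorProduct

namespace Summit.ResolutionOfSingularities.ResolutionOfSingularities.Theorems.RadicialJung.CleanModels

universe u

/-! ## § 1 Differential freeness from a unitriangular system of derivations -/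

/-- For a derivation `D` of the local ring `O` there is a `κ`-linear functional `Ψ : κ ⊗_O Ω_{O/ℤ} → κ` with `Ψ(1 ⊗ dh) = \overline{D h}`
(`κ ⊗ Ω → κ ⊗ κ → κ`, base change of `h ↦ \overline{D h}`). [cite: Giraud1983, 1.1 and Prop. 1.5 (remark p. 114)] -/
theorem exists_residueFunctional {O : Type u} [CommRing O] [IsLocalRing O] (D : Derivation ℤ O O) :
    ∃ Ψ : ResidueField O ⊗[O] Ω[O⁄ℤ] →ₗ[ResidueField O] ResidueField O,
      ∀ h : O, Ψ ((1 : ResidueField O) ⊗ₜ[O] KaehlerDifferential.D ℤ O h) = residue O (D h) := by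
  let χ : Ω[O⁄ℤ] →ₗ[O] ResidueField O := (Algebra.linearMap O (ResidueField O)) ∘ₗ D.liftKaehlerDifferential
  have hχ : ∀ h : O, χ (KaehlerDifferential.D ℤ O h) = residue O (D h) := fun h => by
    change algebraMap O (ResidueField O) (D.liftKaehlerDifferential (KaehlerDifferential.D ℤ O h)) = _
    rw [Derivation.liftKaehlerDifferential_comp_D]
    rfl
  refine ⟨(Algebra.TensorProduct.lmul'' (S := ResidueField O) O).toLinearMap ∘ₗ χ.baseChange (ResidueField O), fun h => ?_⟩
  change Algebra.TensorProduct.lmul' (S := ResidueField O) O (χ.baseChange (ResidueField O) (1 ⊗ₜ _)) = _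
  rw [LinearMap.baseChange_tmul, Algebra.TensorProduct.lmul'_apply_tmul, one_mul, hχ]

/-- **Unitriangular derivations ⇒ differentially free.** If `y : Fin n → O` admits derivations `E : Fin n → Der_ℤ(O)` with `Eᵢ(yᵢ) ∉ 𝔪` and
`Eᵢ(yⱼ) ∈ 𝔪` for `j < i`, then the `1 ⊗ dyⱼ` are `κ`-linearly independent in `κ ⊗_O Ω_{O/ℤ}`. [cite: Giraud1983, 1.1] -/
theorem isDifferentiallyFree_of_triangular {O : Type u} [CommRing O] [IsLocalRing O] {n : ℕ} (y : Fin n → O)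
    (E : Fin n → Derivation ℤ O O) (hdiag : ∀ i, E i (y i) ∉ maximalIdeal O)
    (htri : ∀ i j : Fin n, j < i → E i (y j) ∈ maximalIdeal O) : IsDifferentiallyFree y := by
  classical
  choose Ψ hΨ using fun i => exists_residueFunctional (E i)
  rw [IsDifferentiallyFree, Fintype.linearIndependent_iff]
  intro c hc
  have hrow : ∀ i, ∑ j, c j * residue O (E i (y j)) = 0 := by
    intro i
    have h := congrArg (Ψ i) hc
    rw [map_sum, map_zero] at h
    simpa only [map_smul, hΨ, smul_eq_mul] using h
  -- downward induction on the index
  have key : ∀ d : ℕ, ∀ i : Fin n, n = i.val + 1 + d → c i = 0 := by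
    intro d
    induction d using Nat.strong_induction_on with
    | _ d ih =>
      intro i hi
      have hzero : ∀ j : Fin n, j ≠ i → c j * residue O (E i (y j)) = 0 := by
        intro j hj
        rcases lt_or_gt_of_ne (fun h : j.val = i.val => hj (Fin.ext h)) with hlt | hgt
        · rw [(residue_eq_zero_iff _).mpr (htri i j hlt), mul_zero]
        · rw [ih (n - 1 - j.val) (by omega) j (by omega), zero_mul]
      have h := hrow i
      rw [Finset.sum_eq_single i (fun j _ hj => hzero j hj) (fun h => absurd (Finset.mem_univ i) h)] at h
      rcases mul_eq_zero.mp h with h | h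
      · exact h
      · exact absurd ((residue_eq_zero_iff _).mp h) (hdiag i)
  intro i
  exact key (n - 1 - i.val) i (by omega)

/-! ## § 2 Case (c-1): a unit among `A·u + x∂ₓu`, `B·u + y∂_y u` -/

/-- In a local ring: `A·u + x·v` a unit with `x ∈ 𝔪` forces `u` to be a unit and `p ∤ A` (`p` the residue characteristic: `(p : O) ∈ 𝔪`).
[folklore] -/
theorem isUnit_and_not_dvd_of_isUnit_generator {O : Type u} [CommRing O] [IsLocalRing O] {p : ℕ} (hp : (p : O) ∈ maximalIdeal O)
    {A : ℕ} {u x v : O} (hx : x ∈ maximalIdeal O) (h : IsUnit ((A : O) * u + x * v)) : IsUnit u ∧ ¬ p ∣ A := by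
  have hAu : IsUnit ((A : O) * u) := by
    by_contra hnu
    have hmem : (A : O) * u ∈ maximalIdeal O := by rwa [mem_maximalIdeal, mem_nonunits_iff]
    exact (mem_maximalIdeal _).mp (Ideal.add_mem _ hmem (Ideal.mul_mem_right _ _ hx)) h
  refine ⟨isUnit_of_mul_isUnit_right hAu, fun hdvd => ?_⟩
  obtain ⟨m, rfl⟩ := hdvd
  have : ((p * m : ℕ) : O) * u ∈ maximalIdeal O := by
    rw [Nat.cast_mul, mul_assoc]
    exact Ideal.mul_mem_right _ _ hp
  exact (mem_maximalIdeal _).mp this hAu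

/-- **(c-1), crossing**: `(x, y)` a regular system of parameters of the 2-dimensional local ring `O`, `f = gᵖ + u·x^A·y^B` with `A, B ≥ 2`,
`u` a unit and `p ∤ A` or `p ∤ B` ⇒ Giraud normal form (`d = r = 2`). [cite: Giraud1983, Prop. 1.5 (ii) (c-1)] -/
theorem giraud15NormalFormAt_crossing_of_isUnit {p : ℕ} {O : Type u} [CommRing O] [IsLocalRing O] {x y f g u : O} {A B : ℕ}
    (hxy : Ideal.span {x, y} = maximalIdeal O) (hdim : ringKrullDim O = 2) (hf : f = g ^ p + u * (x ^ A * y ^ B))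
    (hA : 2 ≤ A) (hB : 2 ≤ B) (hu : IsUnit u) (hndvd : ¬ p ∣ A ∨ ¬ p ∣ B) : Giraud15NormalFormAt p f := by
  refine ⟨2, 2, le_rfl, ![x, y], g, u, ![A, B], ?_, by simpa using hdim, ?_, ?_, Or.inl ⟨?_, hu⟩⟩
  · rw [← hxy, Matrix.range_cons, Matrix.range_cons, Matrix.range_empty, Set.union_empty, Set.singleton_union]
  · intro i; fin_cases i <;> simp [hA, hB]
  · rw [hf, Fin.prod_univ_two]
    simp
  · rcases hndvd with h | h
    · exact ⟨0, by simpa using h⟩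
    · exact ⟨1, by simpa using h⟩

/-- **(c-1), non-crossing**: `(x, y)` a regular system of parameters, `f = gᵖ + u·x^A` with `A ≥ 2`, `u` a unit and `p ∤ A` ⇒ Giraud
normal form (`d = 2`, `r = 1`). [cite: Giraud1983, Prop. 1.5 (ii) (c-1)] -/
theorem giraud15NormalFormAt_noncrossing_of_isUnit {p : ℕ} {O : Type u} [CommRing O] [IsLocalRing O] {x y f g u : O} {A : ℕ}
    (hxy : Ideal.span {x, y} = maximalIdeal O) (hdim : ringKrullDim O = 2) (hf : f = g ^ p + u * x ^ A)
    (hA : 2 ≤ A) (hu : IsUnit u) (hndvd : ¬ p ∣ A) : Giraud15NormalFormAt p f := by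
  refine ⟨2, 1, by norm_num, ![x, y], g, u, ![A], ?_, by simpa using hdim, ?_, ?_, Or.inl ⟨⟨0, by simpa using hndvd⟩, hu⟩⟩
  · rw [← hxy, Matrix.range_cons, Matrix.range_cons, Matrix.range_empty, Set.union_empty, Set.singleton_union]
  · intro i; fin_cases i; simp [hA]
  · rw [hf, Fin.prod_univ_one]
    simp

/-- **(c-1) from a unit generator, crossing**: `A·u + x·v` (or `B·u + y·v`) a unit, `(p : O) ∈ 𝔪`. [cite: Giraud1983, Prop. 1.5 (ii) (c-1)] -/
theorem giraud15NormalFormAt_crossing_of_isUnit_generator {p : ℕ} {O : Type u} [CommRing O] [IsLocalRing O]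
    (hp : (p : O) ∈ maximalIdeal O) {x y f g u v : O} {A B : ℕ}
    (hxy : Ideal.span {x, y} = maximalIdeal O) (hdim : ringKrullDim O = 2) (hf : f = g ^ p + u * (x ^ A * y ^ B))
    (hA : 2 ≤ A) (hB : 2 ≤ B) (h : IsUnit ((A : O) * u + x * v) ∨ IsUnit ((B : O) * u + y * v)) : Giraud15NormalFormAt p f := by
  have hx : x ∈ maximalIdeal O := hxy ▸ Ideal.subset_span (by simp)
  have hy : y ∈ maximalIdeal O := hxy ▸ Ideal.subset_span (by simp)
  rcases h with h | h
  · obtain ⟨hu, hndvd⟩ := isUnit_and_not_dvd_of_isUnit_generator hp hx h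
    exact giraud15NormalFormAt_crossing_of_isUnit hxy hdim hf hA hB hu (Or.inl hndvd)
  · obtain ⟨hu, hndvd⟩ := isUnit_and_not_dvd_of_isUnit_generator hp hy h
    exact giraud15NormalFormAt_crossing_of_isUnit hxy hdim hf hA hB hu (Or.inr hndvd)

/-- **(c-1) from a unit generator, non-crossing**: `A·u + x·v` a unit, `(p : O) ∈ 𝔪`. [cite: Giraud1983, Prop. 1.5 (ii) (c-1)] -/
theorem giraud15NormalFormAt_noncrossing_of_isUnit_generator {p : ℕ} {O : Type u} [CommRing O] [IsLocalRing O]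
    (hp : (p : O) ∈ maximalIdeal O) {x y f g u v : O} {A : ℕ}
    (hxy : Ideal.span {x, y} = maximalIdeal O) (hdim : ringKrullDim O = 2) (hf : f = g ^ p + u * x ^ A)
    (hA : 2 ≤ A) (h : IsUnit ((A : O) * u + x * v)) : Giraud15NormalFormAt p f := by
  have hx : x ∈ maximalIdeal O := hxy ▸ Ideal.subset_span (by simp)
  obtain ⟨hu, hndvd⟩ := isUnit_and_not_dvd_of_isUnit_generator hp hx h
  exact giraud15NormalFormAt_noncrossing_of_isUnit hxy hdim hf hA hu hndvd

/-! ## § 3 Case (c-2): a derivation killing the boundary letters (mod `𝔪`) with a unit value on `u` -/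

/-- **(c-2), crossing**: `f = gᵖ + u·x^A·y^B`, `A, B ≥ 2`, dual derivations `δ₀, δ₁` of the parameters (`δ₀ x ∉ 𝔪`, `δ₁ x ∈ 𝔪`,
`δ₁ y ∉ 𝔪`) and a derivation `D` with `D x, D y ∈ 𝔪` and `D u ∉ 𝔪` ⇒ `(x, y, u)` is differentially free and `f` is in Giraud normal form.
[cite: Giraud1983, Prop. 1.5 (ii) (c-2)] -/
theorem giraud15NormalFormAt_crossing_of_derivations {p : ℕ} {O : Type u} [CommRing O] [IsLocalRing O] {x y f g u : O} {A B : ℕ}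
    (hxy : Ideal.span {x, y} = maximalIdeal O) (hdim : ringKrullDim O = 2) (hf : f = g ^ p + u * (x ^ A * y ^ B))
    (hA : 2 ≤ A) (hB : 2 ≤ B) (δ₀ δ₁ D : Derivation ℤ O O) (h₀ : δ₀ x ∉ maximalIdeal O) (h₁x : δ₁ x ∈ maximalIdeal O)
    (h₁ : δ₁ y ∉ maximalIdeal O) (hDx : D x ∈ maximalIdeal O) (hDy : D y ∈ maximalIdeal O) (hDu : D u ∉ maximalIdeal O) :
    Giraud15NormalFormAt p f := by
  refine ⟨2, 2, le_rfl, ![x, y], g, u, ![A, B], ?_, by simpa using hdim, ?_, ?_, Or.inr ?_⟩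
  · rw [← hxy, Matrix.range_cons, Matrix.range_cons, Matrix.range_empty, Set.union_empty, Set.singleton_union]
  · intro i; fin_cases i <;> simp [hA, hB]
  · rw [hf, Fin.prod_univ_two]
    simp
  · -- the family `(x, y, u)` with the derivations `(δ₀, δ₁, D)` is unitriangular
    have hfam : (Fin.snoc (fun i : Fin 2 => (![x, y] : Fin 2 → O) (Fin.castLE le_rfl i)) u : Fin 3 → O) = ![x, y, u] := by
      ext i; fin_cases i <;> rfl
    rw [hfam]
    refine isDifferentiallyFree_of_triangular ![x, y, u] ![δ₀, δ₁, D] (fun i => ?_) (fun i j hij => ?_)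
    · fin_cases i
      · exact h₀
      · exact h₁
      · exact hDu
    · fin_cases i <;> fin_cases j <;> simp_all

/-- **(c-2), non-crossing**: `f = gᵖ + u·x^A`, `A ≥ 2`, a derivation `δ₀` with `δ₀ x ∉ 𝔪` and a derivation `D` with `D x ∈ 𝔪`,
`D u ∉ 𝔪` (e.g. `∂_y` when `∂_y u` is a unit, or a derivation killing `x` and `y`) ⇒ `(x, u)` is differentially free and `f` is in Giraud
normal form. [cite: Giraud1983, Prop. 1.5 (ii) (c-2)] -/
theorem giraud15NormalFormAt_noncrossing_of_derivations {p : ℕ} {O : Type u} [CommRing O] [IsLocalRing O] {x y f g u : O} {A : ℕ}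
    (hxy : Ideal.span {x, y} = maximalIdeal O) (hdim : ringKrullDim O = 2) (hf : f = g ^ p + u * x ^ A) (hA : 2 ≤ A)
    (δ₀ D : Derivation ℤ O O) (h₀ : δ₀ x ∉ maximalIdeal O) (hDx : D x ∈ maximalIdeal O) (hDu : D u ∉ maximalIdeal O) :
    Giraud15NormalFormAt p f := by
  refine ⟨2, 1, by norm_num, ![x, y], g, u, ![A], ?_, by simpa using hdim, ?_, ?_, Or.inr ?_⟩
  · rw [← hxy, Matrix.range_cons, Matrix.range_cons, Matrix.range_empty, Set.union_empty, Set.singleton_union]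
  · intro i; fin_cases i; simp [hA]
  · rw [hf, Fin.prod_univ_one]
    simp
  · have hfam : (Fin.snoc (fun i : Fin 1 => (![x, y] : Fin 2 → O) (Fin.castLE (by norm_num) i)) u : Fin 2 → O) = ![x, u] := by
      ext i; fin_cases i <;> rfl
    rw [hfam]
    refine isDifferentiallyFree_of_triangular ![x, u] ![δ₀, D] (fun i => ?_) (fun i j hij => ?_)
    · fin_cases i
      · exact h₀
      · exact hDu
    · fin_cases i <;> fin_cases j <;> simp_all

end Summit.ResolutionOfSingularities.ResolutionOfSingularities.Theorems.RadicialJung.CleanModels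

end
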